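import Literature.NumberTheory.EllipticCurves.Rank1Residual.Typed.PAdicCertificateSurjectiveThree
import Literature.NumberTheory.EllipticCurves.SteinWuthrich2013.MultiplicativeLeadingTerm
import Literature.NumberTheory.EllipticCurves.IwasawaSelmerModuleFiniteProofs
import HarnessLib

/-!
# The rank-`≤ 1` certificate at a multiplicative prime WITHOUT a leading-term hypothesis: Stein–Wuthrich 2013 Thm. 6.1 (Jones) feeds the engine (cell `b2b-bsdres`)

HONEST FRAMING (run/shared/lean/b2b/bsd-rank1-residual/, verbatim): the goal of the cell is to
DELETE the COMBINATION-SHAPED residual classes for ALL analytic-rank `≤ 1` elliptic curves over `ℚ`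
— "full BSD formula for every rank `≤ 1` curve in class C" assembled STRICTLY from published
theorems — so that the rank-`≤ 1` remainder becomes exactly the CONSTRUCTION-SHAPED classes, which
are TYPED (missing-input `Prop`s), NOT attempted. This is not "finishing BSD".

Theorems only (no definition, no new named fact). Companion of
`Typed/PAdicCertificateMultiplicative.lean` (x11a gen 5: Skinner 2016 Thm. A ∘ engine, p181066) and
`Typed/PAdicCertificateSurjective.lean` (lit gen 5 / x11a gen 6: Wuthrich–Kato surjective-image
divisibility ∘ engine, p181404). Those files left ONE class-level input as an explicit hypothesis
`hLT` ("the Jones clause": IF `ord_{T=0} f_E = rank E(ℚ)` THEN `Ш(E/ℚ)[p^∞]` is finite, the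
regulator is non-zero and `[T^r]f_E · B = u · A · R · #Ш[p^∞]`, for the height one computes with).
That clause is now the PUBLISHED named fact `SteinWuthrich2013.thm61_{split,nonsplit}Multiplicative`
(W. Stein, C. Wuthrich, Math. Comp. 82 (2013) Thm. 6.1 "(Schneider, Perrin-Riou, Jones)", held
`paper:url-055ad7d818a8` p. 20; file `SteinWuthrich2013/MultiplicativeLeadingTerm.lean`) for THE
`p`-adic height of SW §4.2 (predicates `SteinWuthrich2013.IsSplitMultCanonical Dh Dq` /
`IsMultCanonical Dh q`, pinned by explicit Tate-curve formulas), whose projection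
`leadingTerm_shape` is that hypothesis verbatim (`A = 𝓛_p(E) · ∏ c_v` and `B = log_p(γ_cyc)^{r+1} ·
#E(ℚ)_tors²` at a split prime — the normalisers of the tree's exceptional `p`-adic BSD statement,
MTT 1986 §II.10 —, `A = 2 · ∏ c_v` (`ε_p = 2`) and `B = log_p(γ_cyc)^r · #E(ℚ)_tors²` at a
non-split prime, `R = Reg_p(E, Dh)`). So each theorem below has as inputs ONLY: published named
facts (`hA` Skinner Thm. A / `hK` Wuthrich–Kato F35, `hJ` SW Thm. 6.1, `hW` Wuthrich Prop. 21,
`hGZK`, `hmod`, `h𝓛` Barré-Sirieix–Diaz–Gramain–Philibert), the class predicate, the cyclotomic /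
newform / period bookkeeping data of the divisibility facts, a height datum `Dh` PINNED to SW's
height, and the per-curve COMPUTED data: `hordL` (`ord_{T=0} L_p = r + e`), `hcert` (the valuation
of the normalised leading coefficient of `L_p` equals that of `A · Reg_p(E, Dh)` — the quantity
PARI's `ellpadicbsd` / `ellpadicregulator` evaluate; cell jobs j042099/j042317/j042338: `ord_p` of the
`p`-adic analytic `Ш` is `0` at all 141 rank-one `p ‖ N`, `p ≥ 5` pairs of the 2026-08-18 collector),
and `p ∤ #Ш_an` (`hs`, `hv`). `X(E/ℚ_∞)` finitely generated is the tree THEOREM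
`SelmerDualData.module_finite_holds`; `Λ`-torsion is the first clause of `hA` / `hK`.

Consequence for the census (REPORT-g7.md): on the 2026-08-18 collector the 141 rank-one `p ‖ N`,
`p ≥ 5` pairs of X11 type (85 residue ¬sst + 56 semistable `T-CAS`; 91 split, 50 non-split) are
"PUBLISHED named facts + per-curve certificate about DEFINED quantities" — no class-level typed
input remains; the per-curve certificate (a computation: `hordL`, `hcert`, `hs`/`hv`, and the data
`Dq`/`q`, `Dh`) is CONSTRUCTION-shaped. Per curve; NOT a deletion of X11 as a class; no verdict is
changed by this file (the lane certifies).

* `X11.bsdp_of_thmA_split_of_canonical_certificate`, `X11.bsdp_of_thmA_nonsplit_of_canonical_certificate`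
  — (ram) locus, `p ≥ 3` (Skinner Thm. A): 130 of the 141 pairs (and the `p = 3` X11 ∧ ram pairs).
* `bsdp_of_thmA_split_of_canonical_certificate`, `bsdp_of_thmA_nonsplit_of_canonical_certificate` —
  the same without the class predicate (covers the 56 semistable `T-CAS` records verbatim).
* `X11.bsdp_of_katoSurj_split_of_canonical_certificate`, `X11.bsdp_of_katoSurj_nonsplit_of_canonical_certificate`
  — `p ≥ 5`, `ρ̄_{E,p}` surjective (F35, flagged `Wu14-surj-attribution`): all 141 pairs, the 11
  `¬sst ∧ ¬ram` ones included.
* `X11.bsdp_of_katoSurj_{split,nonsplit}_of_surjective_pow_of_canonical_certificate` — any odd `p`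
  with `ρ_{E,p^∞}` surjective (at `p = 3` via Wuthrich's Lemma 20, `surjective_pow_three_of_mult`):
  the x11b `p = 3` X11 ∧ `r = 1` pairs get the same shape (SW's theorem is printed for `p > 2`).

References: Stein–Wuthrich 2013 Thm. 6.1, §4.2 [SteinWuthrich2013]; Skinner 2016 Thm. A
[Skinner2016PacificMC]; Wuthrich 2014 Thm. 3 / Cor. 19 proof / Prop. 21 [Wuthrich2014];
MTT 1986 §II.10 [MazurTateTeitelbaum1986]; Miller 2011 Prop. 7.6 [Miller2011LMS] (the printed
instance 1155k @ 7).
-/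

set_option autoImplicit false

noncomputable section

open scoped Classical MatrixGroups ModularForm

open CongruenceSubgroup WeierstrassCurve Literature.NumberTheory.EllipticCurves
  Literature.NumberTheory.EllipticCurves.ModularForms
  Literature.NumberTheory.EllipticCurves.Rank1Residual
  Literature.NumberTheory.EllipticCurves.Skinner2016
  Literature.NumberTheory.EllipticCurves.Wuthrich2014
  Literature.NumberTheory.EllipticCurves.SteinWuthrich2013

namespace Literature.NumberTheory.EllipticCurves.Rank1Residual.Typed

/-! ### The (ram) locus: Skinner Thm. A ∘ SW Thm. 6.1 ∘ engine -/

/-- **Split multiplicative `p ≥ 3`, (irr) + (ram), analytic rank `≤ 1`, `p ∤ #Ш_an`: `BSD(E,p)` from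
PUBLISHED facts plus the per-curve certificate for THE Stein–Wuthrich height.** Inputs: Skinner 2016
Thm. A (`hA`), SW 2013 Thm. 6.1 split (`hJ`), GZK (`hGZK`), BDGP (`h𝓛`); the Tate parameter datum
`Dq` (split multiplicative reduction, `𝓛_p = LInvariant Dq`), a height datum `Dh` which IS SW's
§4.2 height (`hDh : IsSplitMultCanonical Dh Dq`); cyclotomic / newform / period data as in
`bsdp_of_thmA_split_of_leadingTerm_certificate`; computed: `hordL`, `hcert`
(`ord_p(ϖ · [T^{r+1}]L_p · log_p(γ_cyc)^{r+1} · #E(ℚ)_tors²) = ord_p(𝓛_p · ∏ c_v · Reg_p(E, Dh))`),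
`hs`/`hv` (`p ∤ #Ш_an`). No class predicate (covers the semistable `T-CAS` records). The former
hypothesis `hLT` is `hJ.leadingTerm_shape`. Per curve; NOT a class theorem.
[cite: SteinWuthrich2013, Thm. 6.1 (p. 20) and §4.2] [cite: Skinner2016PacificMC, Thm. A (§1), §3.2]
[cite: Miller2011LMS, Prop. 7.6] -/
theorem bsdp_of_thmA_split_of_canonical_certificate (hA : thmA_charIdeal_multiplicative)
    (hJ : thm61_splitMultiplicative) (hGZK : rank_eq_analyticRank_of_analyticRank_le_one)
    (W : WeierstrassCurve ℚ) [W.IsElliptic] [W.IsGloballyMinimal] (p : ℕ) [Fact p.Prime]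
    (h𝓛 : LInvariant_ne_zero (W := W) (p := p))
    {κ : ZpExtension ℚ p} {γ : Field.absoluteGaloisGroup ℚ} {N : ℕ} [NeZero N]
    {f : CuspForm (Gamma0 N) 2} (hp : 3 ≤ p) (hr : W.analyticRank ≤ 1)
    (Dq : TateParameterData W p) (hirr : W.HasIrreducibleModPGaloisRep p) (hram : Ram W p)
    (Dh : PAdicHeightData W p) (hDh : IsSplitMultCanonical Dh Dq)
    (hκ : κ.IsCyclotomic) (hγ : κ.IsTopGenerator γ) (hγ' : IsCyclotomicVariable p γ)
    (hf : IsNewformOf W f) (D : W.SelmerDualData κ γ) (ϖ : ℚ) (hϖ0 : ϖ ≠ 0)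
    (hϖ : (ϖ : ℝ) * W.realPeriodRat = plusPeriod f)
    (L : PowerSeries ℚ_[p]) (hL : IsSplitMultPAdicLFunctionOf f p L)
    (hordL : L.order = (W.mordellWeilRank + 1 : ℕ))
    (hcert : (((ϖ : ℚ) : ℚ_[p]) * PowerSeries.coeff (W.mordellWeilRank + 1) L *
        (padicLog p (cyclotomicGenerator p) ^ (W.mordellWeilRank + 1) *
          (W.torsionOrder : ℚ_[p]) ^ 2)).valuation =
      (LInvariant Dq * (W.tamagawaProduct : ℚ_[p]) * padicRegulator Dh).valuation)
    {s : ℚ} (hs : shaAn W = (s : ℂ)) (hv : padicValRat p s = 0) : BSDp W p := by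
  haveI : Module.Finite (IwasawaAlgebra p) D.X := D.module_finite_holds hγ
  have hXt : D.IsTorsion := (hA W p hp Dq.split.hasMultiplicativeReductionAtPrime hirr hram hκ hγ hγ'
    hf D ϖ hϖ0 hϖ).1
  have hc0 : (W.tamagawaProduct : ℚ_[p]) ≠ 0 := by
    exact_mod_cast (W.tamagawaProduct_pos_holds : 0 < W.tamagawaProduct).ne'
  have hA0 : LInvariant Dq * (W.tamagawaProduct : ℚ_[p]) ≠ 0 := mul_ne_zero (h𝓛 Dq) hc0
  exact bsdp_of_thmA_split_of_leadingTerm_certificate hA hGZK W p hp hr Dq.split hirr hram hκ hγ hγ'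
    hf D ϖ hϖ0 hϖ L hL hordL _ _ (padicRegulator Dh) hA0
    (hJ.leadingTerm_shape (by omega) Dq hκ hγ hγ' D hXt hDh) hcert hs hv

/-- **Non-split multiplicative `p ≥ 3`, (irr) + (ram), analytic rank `≤ 1`, `p ∤ #Ш_an`: `BSD(E,p)`
from PUBLISHED facts plus the per-curve certificate for THE Stein–Wuthrich height** (formula (4.1);
`hDh : IsMultCanonical Dh q` for the Tate parameter `q` of `E/ℚ_p`, given with `q ≠ 0`, `‖q‖ < 1`,
`j(q) = j(E)`). Normalisers `A = 2 · ∏ c_v` (`ε_p = 2`), `B = log_p(γ_cyc)^r · #E(ℚ)_tors²`,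
`R = Reg_p(E, Dh)`; computed: `hordL` (`ord_{T=0} L_p = r`), `hcert`
(`ord_p(ϖ · [T^r]L_p · log_p(γ_cyc)^r · #E(ℚ)_tors²) = ord_p(2 ∏ c_v · Reg_p(E, Dh))`). No class
predicate. Per curve; NOT a class theorem. [cite: SteinWuthrich2013, Thm. 6.1 (p. 20) and §4.2]
[cite: Skinner2016PacificMC, Thm. A (§1), §3.2] [cite: Miller2011LMS, Prop. 7.6] -/
theorem bsdp_of_thmA_nonsplit_of_canonical_certificate (hA : thmA_charIdeal_multiplicative)
    (hJ : thm61_nonsplitMultiplicative) (hGZK : rank_eq_analyticRank_of_analyticRank_le_one)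
    (W : WeierstrassCurve ℚ) [W.IsElliptic] [W.IsGloballyMinimal] (p : ℕ) [Fact p.Prime]
    {κ : ZpExtension ℚ p} {γ : Field.absoluteGaloisGroup ℚ} {N : ℕ} [NeZero N]
    {f : CuspForm (Gamma0 N) 2} (hp : 3 ≤ p) (hr : W.analyticRank ≤ 1)
    (hmult : W.HasMultiplicativeReductionAtPrime p)
    (hns : ¬ W.HasSplitMultiplicativeReductionAtPrime p) (hirr : W.HasIrreducibleModPGaloisRep p)
    (hram : Ram W p) {q : ℚ_[p]} (hq0 : q ≠ 0) (hq1 : ‖q‖ < 1) (hqj : tateJ q = (W.j : ℚ_[p]))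
    (Dh : PAdicHeightData W p) (hDh : IsMultCanonical Dh q)
    (hκ : κ.IsCyclotomic) (hγ : κ.IsTopGenerator γ) (hγ' : IsCyclotomicVariable p γ)
    (hf : IsNewformOf W f) (D : W.SelmerDualData κ γ) (ϖ : ℚ) (hϖ0 : ϖ ≠ 0)
    (hϖ : (ϖ : ℝ) * W.realPeriodRat = plusPeriod f)
    (L : PowerSeries ℚ_[p]) (hL : IsMultPAdicLFunctionOf f p (-1) L)
    (hordL : L.order = (W.mordellWeilRank : ℕ))
    (hcert : (((ϖ : ℚ) : ℚ_[p]) * PowerSeries.coeff W.mordellWeilRank L *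
        (padicLog p (cyclotomicGenerator p) ^ W.mordellWeilRank *
          (W.torsionOrder : ℚ_[p]) ^ 2)).valuation =
      (2 * (W.tamagawaProduct : ℚ_[p]) * padicRegulator Dh).valuation)
    {s : ℚ} (hs : shaAn W = (s : ℂ)) (hv : padicValRat p s = 0) : BSDp W p := by
  haveI : Module.Finite (IwasawaAlgebra p) D.X := D.module_finite_holds hγ
  have hXt : D.IsTorsion := (hA W p hp hmult hirr hram hκ hγ hγ' hf D ϖ hϖ0 hϖ).1
  have hc0 : (W.tamagawaProduct : ℚ_[p]) ≠ 0 := by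
    exact_mod_cast (W.tamagawaProduct_pos_holds : 0 < W.tamagawaProduct).ne'
  have hA0 : (2 : ℚ_[p]) * (W.tamagawaProduct : ℚ_[p]) ≠ 0 := mul_ne_zero two_ne_zero hc0
  exact bsdp_of_thmA_nonsplit_of_leadingTerm_certificate hA hGZK W p hp hr hmult hns hirr hram hκ hγ
    hγ' hf D ϖ hϖ0 hϖ L hL hordL _ _ (padicRegulator Dh) hA0
    (hJ.leadingTerm_shape (by omega) hmult hns hq0 hq1 hqj hκ hγ hγ' D hXt hDh) hcert hs hv

/-- **X11 ∧ ram, split multiplicative `p ≥ 3`: `BSD(E,p)` from PUBLISHED facts (Skinner Thm. A `hA`,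
SW Thm. 6.1 `hJ`, Wuthrich Prop. 21 `hW`, GZK, modularity, BDGP `h𝓛`) plus the per-curve
certificate for THE Stein–Wuthrich height** (canonical X11 signature; `ClassX11 W p` supplies
multiplicative reduction and (irr)). This is `X11.bsdp_of_thmA_split_of_mtt_certificate` (x11a
gen 5) with its hypothesis `hLT` DISCHARGED by `hJ.leadingTerm_shape`. On the 2026-08-18 collector:
the 48 split (ram) residue pairs and the 38 split `T-CAS` records. Per curve; NOT a deletion of X11.
[cite: SteinWuthrich2013, Thm. 6.1 (p. 20) and §4.2] [cite: Skinner2016PacificMC, Thm. A (§1), §3.2]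
[cite: Wuthrich2014, Prop. 21 (p. 400)] [cite: MazurTateTeitelbaum1986, §II.10] -/
theorem X11.bsdp_of_thmA_split_of_canonical_certificate (hA : thmA_charIdeal_multiplicative)
    (hJ : thm61_splitMultiplicative) (hW : Wuthrich2014.sha_dvd_analyticSha)
    (hGZK : rank_eq_analyticRank_of_analyticRank_le_one) (hmod : hasEntireLFunction_rat)
    (W : WeierstrassCurve ℚ) [W.IsElliptic] [W.IsGloballyMinimal] (p : ℕ) [Fact p.Prime]
    (h𝓛 : LInvariant_ne_zero (W := W) (p := p))
    {κ : ZpExtension ℚ p} {γ : Field.absoluteGaloisGroup ℚ} {N : ℕ} [NeZero N]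
    {f : CuspForm (Gamma0 N) 2} (hp : 3 ≤ p) (hr : W.analyticRank ≤ 1) (hX : ClassX11 W p)
    (hram : Ram W p) (Dq : TateParameterData W p)
    (Dh : PAdicHeightData W p) (hDh : IsSplitMultCanonical Dh Dq)
    (hκ : κ.IsCyclotomic) (hγ : κ.IsTopGenerator γ) (hγ' : IsCyclotomicVariable p γ)
    (hf : IsNewformOf W f) (D : W.SelmerDualData κ γ) (ϖ : ℚ) (hϖ0 : ϖ ≠ 0)
    (hϖ : (ϖ : ℝ) * W.realPeriodRat = plusPeriod f)
    (L : PowerSeries ℚ_[p]) (hL : IsSplitMultPAdicLFunctionOf f p L)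
    (hordL : L.order = (W.mordellWeilRank + 1 : ℕ))
    (hcert : (((ϖ : ℚ) : ℚ_[p]) * PowerSeries.coeff (W.mordellWeilRank + 1) L *
        (padicLog p (cyclotomicGenerator p) ^ (W.mordellWeilRank + 1) *
          (W.torsionOrder : ℚ_[p]) ^ 2)).valuation =
      (LInvariant Dq * (W.tamagawaProduct : ℚ_[p]) * padicRegulator Dh).valuation)
    {s : ℚ} (hs : shaAn W = (s : ℂ)) (hv : padicValRat p s = 0) : BSDp W p := by
  haveI : Module.Finite (IwasawaAlgebra p) D.X := D.module_finite_holds hγ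
  have hXt : D.IsTorsion := (hA W p hp hX.1 hX.2.1 hram hκ hγ hγ' hf D ϖ hϖ0 hϖ).1
  exact X11.bsdp_of_thmA_split_of_mtt_certificate hA hW hGZK hmod W p hp hr hX hram Dq (h𝓛 Dq) Dh hκ
    hγ hγ' hf D ϖ hϖ0 hϖ L hL hordL (hJ.leadingTerm_shape (by omega) Dq hκ hγ hγ' D hXt hDh) hcert
    hs hv

/-- **X11 ∧ ram, NON-split multiplicative `p ≥ 3`: `BSD(E,p)` from PUBLISHED facts plus the
per-curve certificate for THE Stein–Wuthrich height** (formula (4.1) at `p`; `hDh : IsMultCanonical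
Dh q`, `q` the Tate parameter of `E/ℚ_p`). `X11.bsdp_of_thmA_nonsplit_of_leadingTerm_certificate`
(x11a gen 5) with `A = 2 ∏ c_v`, `B = log_p(γ_cyc)^r #E(ℚ)_tors²`, `R = Reg_p(E, Dh)` and `hLT`
DISCHARGED by `hJ.leadingTerm_shape`. On the 2026-08-18 collector: the 26 non-split (ram) residue
pairs and the 18 non-split `T-CAS` records. Per curve; NOT a deletion of X11.
[cite: SteinWuthrich2013, Thm. 6.1 (p. 20), §3.1 (p. 9), §4.2] [cite: Skinner2016PacificMC, Thm. A (§1), §3.2]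
[cite: Wuthrich2014, Prop. 21 (p. 400)] -/
theorem X11.bsdp_of_thmA_nonsplit_of_canonical_certificate (hA : thmA_charIdeal_multiplicative)
    (hJ : thm61_nonsplitMultiplicative) (hW : Wuthrich2014.sha_dvd_analyticSha)
    (hGZK : rank_eq_analyticRank_of_analyticRank_le_one) (hmod : hasEntireLFunction_rat)
    (W : WeierstrassCurve ℚ) [W.IsElliptic] [W.IsGloballyMinimal] (p : ℕ) [Fact p.Prime]
    {κ : ZpExtension ℚ p} {γ : Field.absoluteGaloisGroup ℚ} {N : ℕ} [NeZero N]
    {f : CuspForm (Gamma0 N) 2} (hp : 3 ≤ p) (hr : W.analyticRank ≤ 1) (hX : ClassX11 W p)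
    (hram : Ram W p) (hns : ¬ W.HasSplitMultiplicativeReductionAtPrime p)
    {q : ℚ_[p]} (hq0 : q ≠ 0) (hq1 : ‖q‖ < 1) (hqj : tateJ q = (W.j : ℚ_[p]))
    (Dh : PAdicHeightData W p) (hDh : IsMultCanonical Dh q)
    (hκ : κ.IsCyclotomic) (hγ : κ.IsTopGenerator γ) (hγ' : IsCyclotomicVariable p γ)
    (hf : IsNewformOf W f) (D : W.SelmerDualData κ γ) (ϖ : ℚ) (hϖ0 : ϖ ≠ 0)
    (hϖ : (ϖ : ℝ) * W.realPeriodRat = plusPeriod f)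
    (L : PowerSeries ℚ_[p]) (hL : IsMultPAdicLFunctionOf f p (-1) L)
    (hordL : L.order = (W.mordellWeilRank : ℕ))
    (hcert : (((ϖ : ℚ) : ℚ_[p]) * PowerSeries.coeff W.mordellWeilRank L *
        (padicLog p (cyclotomicGenerator p) ^ W.mordellWeilRank *
          (W.torsionOrder : ℚ_[p]) ^ 2)).valuation =
      (2 * (W.tamagawaProduct : ℚ_[p]) * padicRegulator Dh).valuation)
    {s : ℚ} (hs : shaAn W = (s : ℂ)) (hv : padicValRat p s = 0) : BSDp W p := by
  haveI : Module.Finite (IwasawaAlgebra p) D.X := D.module_finite_holds hγ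
  have hXt : D.IsTorsion := (hA W p hp hX.1 hX.2.1 hram hκ hγ hγ' hf D ϖ hϖ0 hϖ).1
  have hc0 : (W.tamagawaProduct : ℚ_[p]) ≠ 0 := by
    exact_mod_cast (W.tamagawaProduct_pos_holds : 0 < W.tamagawaProduct).ne'
  have hA0 : (2 : ℚ_[p]) * (W.tamagawaProduct : ℚ_[p]) ≠ 0 := mul_ne_zero two_ne_zero hc0
  exact X11.bsdp_of_thmA_nonsplit_of_leadingTerm_certificate hA hW hGZK hmod W p hp hr hX hram hns hκ
    hγ hγ' hf D ϖ hϖ0 hϖ L hL hordL _ _ (padicRegulator Dh) hA0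
    (hJ.leadingTerm_shape (by omega) hX.1 hns hq0 hq1 hqj hκ hγ hγ' D hXt hDh) hcert hs hv

/-! ### The surjective-image locus: Wuthrich–Kato F35 ∘ SW Thm. 6.1 ∘ engine -/

/-- **X11, split multiplicative `p ≥ 5`, `ρ̄_{E,p}` surjective: `BSD(E,p)` from PUBLISHED facts
(Wuthrich–Kato surjective-image divisibility `hK` — F35, flagged `Wu14-surj-attribution`; also
printed as Stein–Wuthrich 2013 Thm. 7.3 "Suppose that `E` has semistable reduction at `p` and that
`ρ_p` is surjective. Then there exists a series `d(T)` in `Λ` such that `L_p(E,T) = f_E(T) · d(T)`. If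
the reduction is split multiplicative then `T` divides `d(T)`", p. 22 —, SW Thm. 6.1 `hJ`,
Wuthrich Prop. 21 `hW`, GZK, modularity, BDGP `h𝓛`) plus the per-curve certificate for THE
Stein–Wuthrich height.** `X11.bsdp_of_katoSurj_split_of_mtt_certificate` (x11a gen 6) with `hLT`
DISCHARGED. No (ram), no semistability: all 59 split rank-one residue pairs incl. the 5 split
`¬sst ∧ ¬ram` ones. Per curve; NOT a deletion of X11. [cite: SteinWuthrich2013, Thm. 6.1 (p. 20), Thm. 7.3 (p. 22), §4.2]
[cite: Wuthrich2014, Thm. 3 and §1 (p. 382); Cor. 19 proof, first case (p. 394); Prop. 21 (p. 400)]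
[cite: MazurTateTeitelbaum1986, §II.10] -/
theorem X11.bsdp_of_katoSurj_split_of_canonical_certificate
    (hK : kato_charIdeal_dvd_multiplicative_of_surjective) (hJ : thm61_splitMultiplicative)
    (hW : Wuthrich2014.sha_dvd_analyticSha) (hGZK : rank_eq_analyticRank_of_analyticRank_le_one)
    (hmod : hasEntireLFunction_rat)
    (W : WeierstrassCurve ℚ) [W.IsElliptic] [W.IsGloballyMinimal] (p : ℕ) [Fact p.Prime]
    (h𝓛 : LInvariant_ne_zero (W := W) (p := p))
    {κ : ZpExtension ℚ p} {γ : Field.absoluteGaloisGroup ℚ} {N : ℕ} [NeZero N]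
    {f : CuspForm (Gamma0 N) 2} (hp5 : 5 ≤ p) (hr : W.analyticRank ≤ 1) (hX : ClassX11 W p)
    (hρ : Surj W p) (Dq : TateParameterData W p)
    (Dh : PAdicHeightData W p) (hDh : IsSplitMultCanonical Dh Dq)
    (hκ : κ.IsCyclotomic) (hγ : κ.IsTopGenerator γ) (hγ' : IsCyclotomicVariable p γ)
    (hf : IsNewformOf W f) (D : W.SelmerDualData κ γ) (ϖ : ℚ) (hϖ0 : ϖ ≠ 0)
    (hϖ : (ϖ : ℝ) * W.realPeriodRat = plusPeriod f)
    (L : PowerSeries ℚ_[p]) (hL : IsSplitMultPAdicLFunctionOf f p L)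
    (hordL : L.order = (W.mordellWeilRank + 1 : ℕ))
    (hcert : (((ϖ : ℚ) : ℚ_[p]) * PowerSeries.coeff (W.mordellWeilRank + 1) L *
        (padicLog p (cyclotomicGenerator p) ^ (W.mordellWeilRank + 1) *
          (W.torsionOrder : ℚ_[p]) ^ 2)).valuation =
      (LInvariant Dq * (W.tamagawaProduct : ℚ_[p]) * padicRegulator Dh).valuation)
    {s : ℚ} (hs : shaAn W = (s : ℂ)) (hv : padicValRat p s = 0) : BSDp W p := by
  haveI : Module.Finite (IwasawaAlgebra p) D.X := D.module_finite_holds hγ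
  have hXt : D.IsTorsion := (hK W p (by omega) hX.1
    (kato_charIdeal_dvd_multiplicative_of_surjective.surjective_pow_of_five_le W p hp5 hρ)
    hκ hγ hγ' hf D ϖ hϖ).1
  exact X11.bsdp_of_katoSurj_split_of_mtt_certificate hK hW hGZK hmod W p hp5 hr hX hρ Dq (h𝓛 Dq) Dh
    hκ hγ hγ' hf D ϖ hϖ0 hϖ L hL hordL (hJ.leadingTerm_shape (by omega) Dq hκ hγ hγ' D hXt hDh)
    hcert hs hv

/-- **X11, NON-split multiplicative `p ≥ 5`, `ρ̄_{E,p}` surjective: `BSD(E,p)` from PUBLISHED facts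
plus the per-curve certificate for THE Stein–Wuthrich height** (formula (4.1)).
`X11.bsdp_of_katoSurj_nonsplit_of_leadingTerm_certificate` (x11a gen 6) with `A = 2 ∏ c_v`,
`B = log_p(γ_cyc)^r #E(ℚ)_tors²`, `R = Reg_p(E, Dh)` and `hLT` DISCHARGED by `hJ.leadingTerm_shape`.
All 26 non-split rank-one residue pairs incl. the 6 non-split `¬sst ∧ ¬ram` ones. Per curve; NOT a
deletion of X11. [cite: SteinWuthrich2013, Thm. 6.1 (p. 20), Thm. 7.3 (p. 22), §3.1 (p. 9), §4.2]
[cite: Wuthrich2014, Thm. 3 and §1 (p. 382); Prop. 21 (p. 400)] [cite: Miller2011LMS, Prop. 7.6] -/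
theorem X11.bsdp_of_katoSurj_nonsplit_of_canonical_certificate
    (hK : kato_charIdeal_dvd_multiplicative_of_surjective) (hJ : thm61_nonsplitMultiplicative)
    (hW : Wuthrich2014.sha_dvd_analyticSha) (hGZK : rank_eq_analyticRank_of_analyticRank_le_one)
    (hmod : hasEntireLFunction_rat)
    (W : WeierstrassCurve ℚ) [W.IsElliptic] [W.IsGloballyMinimal] (p : ℕ) [Fact p.Prime]
    {κ : ZpExtension ℚ p} {γ : Field.absoluteGaloisGroup ℚ} {N : ℕ} [NeZero N]
    {f : CuspForm (Gamma0 N) 2} (hp5 : 5 ≤ p) (hr : W.analyticRank ≤ 1) (hX : ClassX11 W p)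
    (hρ : Surj W p) (hns : ¬ W.HasSplitMultiplicativeReductionAtPrime p)
    {q : ℚ_[p]} (hq0 : q ≠ 0) (hq1 : ‖q‖ < 1) (hqj : tateJ q = (W.j : ℚ_[p]))
    (Dh : PAdicHeightData W p) (hDh : IsMultCanonical Dh q)
    (hκ : κ.IsCyclotomic) (hγ : κ.IsTopGenerator γ) (hγ' : IsCyclotomicVariable p γ)
    (hf : IsNewformOf W f) (D : W.SelmerDualData κ γ) (ϖ : ℚ) (hϖ0 : ϖ ≠ 0)
    (hϖ : (ϖ : ℝ) * W.realPeriodRat = plusPeriod f)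
    (L : PowerSeries ℚ_[p]) (hL : IsMultPAdicLFunctionOf f p (-1) L)
    (hordL : L.order = (W.mordellWeilRank : ℕ))
    (hcert : (((ϖ : ℚ) : ℚ_[p]) * PowerSeries.coeff W.mordellWeilRank L *
        (padicLog p (cyclotomicGenerator p) ^ W.mordellWeilRank *
          (W.torsionOrder : ℚ_[p]) ^ 2)).valuation =
      (2 * (W.tamagawaProduct : ℚ_[p]) * padicRegulator Dh).valuation)
    {s : ℚ} (hs : shaAn W = (s : ℂ)) (hv : padicValRat p s = 0) : BSDp W p := by
  haveI : Module.Finite (IwasawaAlgebra p) D.X := D.module_finite_holds hγ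
  have hXt : D.IsTorsion := (hK W p (by omega) hX.1
    (kato_charIdeal_dvd_multiplicative_of_surjective.surjective_pow_of_five_le W p hp5 hρ)
    hκ hγ hγ' hf D ϖ hϖ).1
  have hc0 : (W.tamagawaProduct : ℚ_[p]) ≠ 0 := by
    exact_mod_cast (W.tamagawaProduct_pos_holds : 0 < W.tamagawaProduct).ne'
  have hA0 : (2 : ℚ_[p]) * (W.tamagawaProduct : ℚ_[p]) ≠ 0 := mul_ne_zero two_ne_zero hc0
  exact X11.bsdp_of_katoSurj_nonsplit_of_leadingTerm_certificate hK hW hGZK hmod W p hp5 hr hX hρ hns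
    hκ hγ hγ' hf D ϖ hϖ0 hϖ L hL hordL _ _ (padicRegulator Dh) hA0
    (hJ.leadingTerm_shape (by omega) hX.1 hns hq0 hq1 hqj hκ hγ hγ' D hXt hDh) hcert hs hv

/-! ### Any odd `p` with `ρ_{E,p^∞}` surjective (serves `p = 3` via Wuthrich's Lemma 20) -/

/-- **X11, split multiplicative odd `p`, `ρ_{E,p^∞}` surjective (`∀ n`), analytic rank `≤ 1`,
`p ∤ #Ш_an`: `BSD(E,p)` from PUBLISHED facts plus the per-curve certificate for THE Stein–Wuthrich
height.** `X11.bsdp_of_katoSurj_split_of_surjective_pow` (lit gen 5, `Typed/PAdicCertificateSurjectiveThree.lean`)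
with `A = 𝓛_p ∏ c_v`, `B = log_p(γ_cyc)^{r+1} #E(ℚ)_tors²`, `R = Reg_p(E, Dh)` and `hLT` DISCHARGED by
`hJ.leadingTerm_shape` (SW's theorem is printed for `p > 2`). At `p = 3` the binder `hρ` is supplied by
`surjective_pow_three_of_mult` (Wuthrich Lemma 20) from `Surj W 3`. Per curve; NOT a deletion of X11.
[cite: SteinWuthrich2013, Thm. 6.1 (p. 20) and §4.2] [cite: Wuthrich2014, Cor. 19 proof (p. 394); Lemma 20 (p. 400); Prop. 21 (p. 400)] -/
theorem X11.bsdp_of_katoSurj_split_of_surjective_pow_of_canonical_certificate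
    (hK : kato_charIdeal_dvd_multiplicative_of_surjective) (hJ : thm61_splitMultiplicative)
    (hW : Wuthrich2014.sha_dvd_analyticSha) (hGZK : rank_eq_analyticRank_of_analyticRank_le_one)
    (hmod : hasEntireLFunction_rat)
    (W : WeierstrassCurve ℚ) [W.IsElliptic] [W.IsGloballyMinimal] (p : ℕ) [Fact p.Prime]
    (h𝓛 : LInvariant_ne_zero (W := W) (p := p))
    {κ : ZpExtension ℚ p} {γ : Field.absoluteGaloisGroup ℚ} {N : ℕ} [NeZero N]
    {f : CuspForm (Gamma0 N) 2} (hp : p ≠ 2) (hr : W.analyticRank ≤ 1) (hX : ClassX11 W p)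
    (hρ : ∀ n : ℕ, W.HasSurjectiveModNGaloisRep (p ^ n : ℕ)) (Dq : TateParameterData W p)
    (Dh : PAdicHeightData W p) (hDh : IsSplitMultCanonical Dh Dq)
    (hκ : κ.IsCyclotomic) (hγ : κ.IsTopGenerator γ) (hγ' : IsCyclotomicVariable p γ)
    (hf : IsNewformOf W f) (D : W.SelmerDualData κ γ) (ϖ : ℚ) (hϖ0 : ϖ ≠ 0)
    (hϖ : (ϖ : ℝ) * W.realPeriodRat = plusPeriod f)
    (L : PowerSeries ℚ_[p]) (hL : IsSplitMultPAdicLFunctionOf f p L)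
    (hordL : L.order = (W.mordellWeilRank + 1 : ℕ))
    (hcert : (((ϖ : ℚ) : ℚ_[p]) * PowerSeries.coeff (W.mordellWeilRank + 1) L *
        (padicLog p (cyclotomicGenerator p) ^ (W.mordellWeilRank + 1) *
          (W.torsionOrder : ℚ_[p]) ^ 2)).valuation =
      (LInvariant Dq * (W.tamagawaProduct : ℚ_[p]) * padicRegulator Dh).valuation)
    {s : ℚ} (hs : shaAn W = (s : ℂ)) (hv : padicValRat p s = 0) : BSDp W p := by
  haveI : Module.Finite (IwasawaAlgebra p) D.X := D.module_finite_holds hγ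
  have hXt : D.IsTorsion := (hK W p hp hX.1 hρ hκ hγ hγ' hf D ϖ hϖ).1
  have hc0 : (W.tamagawaProduct : ℚ_[p]) ≠ 0 := by
    exact_mod_cast (W.tamagawaProduct_pos_holds : 0 < W.tamagawaProduct).ne'
  have hA0 : LInvariant Dq * (W.tamagawaProduct : ℚ_[p]) ≠ 0 := mul_ne_zero (h𝓛 Dq) hc0
  exact X11.bsdp_of_katoSurj_split_of_surjective_pow hK hW hGZK hmod W p hp hr hX hρ Dq.split hκ hγ hγ'
    hf D ϖ hϖ0 hϖ L hL hordL _ _ (padicRegulator Dh) hA0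
    (hJ.leadingTerm_shape hp Dq hκ hγ hγ' D hXt hDh) hcert hs hv

/-- **X11, NON-split multiplicative odd `p`, `ρ_{E,p^∞}` surjective (`∀ n`), analytic rank `≤ 1`,
`p ∤ #Ш_an`: `BSD(E,p)` from PUBLISHED facts plus the per-curve certificate for THE Stein–Wuthrich
height** (formula (4.1)). `X11.bsdp_of_katoSurj_nonsplit_of_surjective_pow` with `A = 2 ∏ c_v`,
`B = log_p(γ_cyc)^r #E(ℚ)_tors²`, `R = Reg_p(E, Dh)` and `hLT` DISCHARGED. Per curve; NOT a deletion
of X11. [cite: SteinWuthrich2013, Thm. 6.1 (p. 20), §3.1 (p. 9), §4.2]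
[cite: Wuthrich2014, Thm. 3 and §1 (p. 382); Lemma 20 (p. 400); Prop. 21 (p. 400)] -/
theorem X11.bsdp_of_katoSurj_nonsplit_of_surjective_pow_of_canonical_certificate
    (hK : kato_charIdeal_dvd_multiplicative_of_surjective) (hJ : thm61_nonsplitMultiplicative)
    (hW : Wuthrich2014.sha_dvd_analyticSha) (hGZK : rank_eq_analyticRank_of_analyticRank_le_one)
    (hmod : hasEntireLFunction_rat)
    (W : WeierstrassCurve ℚ) [W.IsElliptic] [W.IsGloballyMinimal] (p : ℕ) [Fact p.Prime]
    {κ : ZpExtension ℚ p} {γ : Field.absoluteGaloisGroup ℚ} {N : ℕ} [NeZero N]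
    {f : CuspForm (Gamma0 N) 2} (hp : p ≠ 2) (hr : W.analyticRank ≤ 1) (hX : ClassX11 W p)
    (hρ : ∀ n : ℕ, W.HasSurjectiveModNGaloisRep (p ^ n : ℕ))
    (hns : ¬ W.HasSplitMultiplicativeReductionAtPrime p)
    {q : ℚ_[p]} (hq0 : q ≠ 0) (hq1 : ‖q‖ < 1) (hqj : tateJ q = (W.j : ℚ_[p]))
    (Dh : PAdicHeightData W p) (hDh : IsMultCanonical Dh q)
    (hκ : κ.IsCyclotomic) (hγ : κ.IsTopGenerator γ) (hγ' : IsCyclotomicVariable p γ)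
    (hf : IsNewformOf W f) (D : W.SelmerDualData κ γ) (ϖ : ℚ) (hϖ0 : ϖ ≠ 0)
    (hϖ : (ϖ : ℝ) * W.realPeriodRat = plusPeriod f)
    (L : PowerSeries ℚ_[p]) (hL : IsMultPAdicLFunctionOf f p (-1) L)
    (hordL : L.order = (W.mordellWeilRank : ℕ))
    (hcert : (((ϖ : ℚ) : ℚ_[p]) * PowerSeries.coeff W.mordellWeilRank L *
        (padicLog p (cyclotomicGenerator p) ^ W.mordellWeilRank *
          (W.torsionOrder : ℚ_[p]) ^ 2)).valuation =
      (2 * (W.tamagawaProduct : ℚ_[p]) * padicRegulator Dh).valuation)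
    {s : ℚ} (hs : shaAn W = (s : ℂ)) (hv : padicValRat p s = 0) : BSDp W p := by
  haveI : Module.Finite (IwasawaAlgebra p) D.X := D.module_finite_holds hγ
  have hXt : D.IsTorsion := (hK W p hp hX.1 hρ hκ hγ hγ' hf D ϖ hϖ).1
  have hc0 : (W.tamagawaProduct : ℚ_[p]) ≠ 0 := by
    exact_mod_cast (W.tamagawaProduct_pos_holds : 0 < W.tamagawaProduct).ne'
  have hA0 : (2 : ℚ_[p]) * (W.tamagawaProduct : ℚ_[p]) ≠ 0 := mul_ne_zero two_ne_zero hc0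
  exact X11.bsdp_of_katoSurj_nonsplit_of_surjective_pow hK hW hGZK hmod W p hp hr hX hρ hns hκ hγ hγ'
    hf D ϖ hϖ0 hϖ L hL hordL _ _ (padicRegulator Dh) hA0
    (hJ.leadingTerm_shape hp hX.1 hns hq0 hq1 hqj hκ hγ hγ' D hXt hDh) hcert hs hv

end Literature.NumberTheory.EllipticCurves.Rank1Residual.Typed

end
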